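import Mathlib

/-!
# Anchor algebra certificate for the `D₈`-symmetric member `(a,b,c) = (√2−1, 1, √2+1)` of
# `y² = x(x²−a²)(x²−b²)(x²−c²)` (solo-blind s60)

Companion of `SoloBlindWeilDetFlat` (Gauss–Manin trace certificate).  The moving-endpoint determinant
transport of that file reduces the exceptional Weil relation `D_even = −π·Ω_E/(3√(abc))` of the family to ONE
member; the solo-blind notes (`paper/weil-det.md` §4, `paper/selfref-s60.md` §C) anchor it at the member whose
branch set `{0, ±(√2−1), ±1, ±(√2+1), ∞} = {tan(kπ/8)}` is one orbit of the rotation by `π/8`, where the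
Jacobian splits (`J ~ E″ × J(C₂)`, `E″ : v² = w³ − 4w`, `C₂ : v′² = w⁵ − 16w`, `w = x − 1/x`) and the Weil
class becomes Lefschetz.  This file certifies, sorry-free and by `ring`/`linear_combination`/`norm_num` only,
the algebra used there:
* `fA_eq_family` : at `r² = 2`, `x(x²−(r−1)²)(x²−1)(x²−(r+1)²) = f_A(x) := x⁷ − 7x⁵ + 7x³ − x` (integer model);
  `anchor_relations` : `(r−1)(r+1) = 1`, `(r−1)²+(r+1)² = 6`, `a² + 2a − 1 = 0` for `a = r − 1`.
* `FA_flip` / `fA_eps` : the extra involution `ε : (x,y) ↦ (−1/x, y/x⁴)`, i.e. `x⁸·f_A(−1/x) = f_A(x)`.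
* `fA_Eform`, `fA_C2form`, `quotientE`, `quotientC2` : the quotient curves `v² = w³ − 4w` (`v = y/x²`) and
  `v′² = w⁵ − 16w` (`v′ = y(x²+1)/x³`), `w = x − 1/x`, as division-free polynomial identities and as field identities.
* `tan_pi_div_eight`, `rot_orbit`, `FA_rot` : `tan(π/8) = √2 − 1`; the Möbius rotation `μ(x) = (x+a)/(1−ax)`
  (`a² + 2a − 1 = 0`) cycles `0 → a → 1 → a+2 → ∞ → −(a+2) → −1 → −a → 0`; and the binary octic branch form
  `F_A(p,q) = q⁸f_A(p/q)` is a relative invariant: `F_A(x+a, 1−ax) = −(1+a²)⁴·F_A(x,1)` (so `μ` lifts to `Aut C′`).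
* `FA_cayley` : `F_A(i(1−z), 1+z) = 16i(z⁸ − 1)` whenever `i² = −1` — the Cayley transform `x = tan θ`,
  `z = e^{2iθ}` carries the branch set to the 8th roots of unity: `C′_anchor ≅_ℂ {y² = x⁸ − 1}`.
* `exact_k1/2/3` (+ `fAd_eq_derivative`, `dquot`) : `x·f_A′ − 2k·f_A` for `k = 1,2,3`, i.e. the exact forms
  `d(y/x^k) = (x f′ − 2k f) dx/(2x^{k+1}y)`, giving the cohomology reductions
  `[x⁻¹dx/y] = −5ω₅ + 21ω₃ − 7ω₁`, `[x⁻²dx/y] = −ω₄ + (7/3)(ω₂ + ω₀)`, `[x⁻³dx/y] = −21ω₅ + 88ω₃ − (154/5)ω₁`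
  (`ω_α = x^α dx/y`); `exact_k2_general` is the whole-family version `x f′ − 4f = 3x⁷ − s₁x⁵ − s₂x³ + 3s₃x`.
* `epsEven_sq`, `epsOdd_sq`, `*_fixed`, `*_anti`, `evenFrame_det`, `oddFrame_det` : with
  `ε*(x^α dx/y) = (−1)^α x^{2−α} dx/y` and the reductions above, the matrices of `ε*` on the `σ′`-eigen-frames
  `E = ⟨ω₀,ω₂,ω₄⟩`, `O = ⟨ω₁,ω₃,ω₅⟩` are involutions; invariant lines `ω₊ = ω₀+ω₂` (from `E″`), `η₊ = 7ω₁−20ω₃+5ω₅`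
  (`= [w dw/v]`); anti-invariant planes `⟨ω₋, ω₄ − (7/6)ω₊⟩`, `⟨ω₁, θ = −22ω₃+5ω₅⟩` (from `C₂`); the adapted
  frames have determinant `2` resp. `−10` over the monomial frames.
* `det_one_col`, `det_one_col_anchor`, `det_third_col` : the cofactor expansions turning the 3×3 period
  determinants into `Ω_E/√2 · Ω₂ · [(σ−γ)r₁₄ + (σ+γ)r₂₄ − 2σ r₃₄]` (even) and `Q₁m₁ − Q₂m₂ + Q₃m₃` (odd).
* `E2_c4`, `E2_Δ`, `E2_j` : the CM curve `E₂ : T² = (z+2)(z²−2)` has `c₄ = 160`, `Δ = 512`, `c₄³ = 8000·Δ`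
  (`j = 8000 = j(ℤ[√−2])`).
Numerical companions (not certified here): kit j223212 / j223378 (90-digit anchor periods: the splitting
identities, the cofactor identity `Ω₂[(σ−γ)r₁₄+(σ+γ)r₂₄−2σr₃₄] + (2√2/3)π = 0`, `Q_k = (√2π/Ω_E)(−1,1,−1)`,
minors `m = (√2π/2)(1,1,0)`).  Bearing on the summit statement: none directly — a by-product certificate of the
solo-blind programme (exceptional-Hodge-class test of the period calculus, `paper/weil-det.md`).
-/

namespace Summit.KontsevichZagierPeriods.KontsevichZagierPeriods.Theorems
namespace SoloBlind
namespace AnchorFrame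

section ring
variable {R : Type*} [CommRing R]

/-- The anchor septic `f_A(x) = x⁷ − 7x⁵ + 7x³ − x`. -/
def fA (x : R) : R := x^7 - 7*x^5 + 7*x^3 - x

/-- Its `x`-derivative `f_A′(x) = 7x⁶ − 35x⁴ + 21x² − 1`. -/
def fAd (x : R) : R := 7*x^6 - 35*x^4 + 21*x^2 - 1

/-- The binary octic branch form `F_A(p,q) = q⁸·f_A(p/q) = p⁷q − 7p⁵q³ + 7p³q⁵ − pq⁷` (it vanishes at `∞ = [1:0]`). -/
def FA (p q : R) : R := p^7*q - 7*p^5*q^3 + 7*p^3*q^5 - p*q^7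

variable (r a c x p q : R)

/-- `F_A(x,1) = f_A(x)`. -/
theorem FA_one : FA x 1 = fA x := by unfold FA fA; ring

/-- `F_A = pq(p²−q²)(p⁴−6p²q²+q⁴)`: branch points `0, ∞, ±1` and the roots `±(√2∓1)` of `x⁴ − 6x² + 1`. -/
theorem FA_factor : FA p q = p*q*(p^2 - q^2)*(p^4 - 6*p^2*q^2 + q^4) := by unfold FA; ring

/-- At the anchor (`r = √2`, `a = r−1`, `b = 1`, `c = r+1`) the family polynomial is the integer septic `f_A`. -/
theorem fA_eq_family (hr : r^2 = 2) :
    x * (x^2 - (r - 1)^2) * (x^2 - 1) * (x^2 - (r + 1)^2) = fA x := by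
  unfold fA; linear_combination (x*(x^2 - 1)*(r^2 - 2*x^2)) * hr

/-- The anchor relations: `ac = b² = 1`, `a² + c² = 6`, `c − a = 2`, and `a = √2−1` satisfies `a² + 2a − 1 = 0`. -/
theorem anchor_relations (hr : r^2 = 2) :
    (r - 1) * (r + 1) = 1 ∧ (r - 1)^2 + (r + 1)^2 = 6 ∧ (r + 1) - (r - 1) = 2 ∧ (r - 1)^2 + 2*(r - 1) - 1 = 0 := by
  refine ⟨?_, ?_, ?_, ?_⟩
  · linear_combination hr
  · linear_combination 2 * hr
  · ring
  · linear_combination hr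

/-- Division-free form of the extra involution `ε : x ↦ −1/x`: `F_A(−q, p) = F_A(p, q)`. -/
theorem FA_flip : FA (-q) p = FA p q := by unfold FA; ring

/-- `E″`: `x⁴·(w³ − 4w) = f_A(x)` with `w = x − 1/x`, written division-free. -/
theorem fA_Eform : fA x = x*(x^2 - 1)^3 - 4*x^3*(x^2 - 1) := by unfold fA; ring

/-- `C₂`: `x⁶·(w⁵ − 16w) = f_A(x)·(x²+1)²` with `w = x − 1/x`, written division-free. -/
theorem fA_C2form : fA x * (x^2 + 1)^2 = x*(x^2 - 1)^5 - 16*x^5*(x^2 - 1) := by unfold fA; ring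

/-- Standard models: `w = 2X` gives `v² = 8(X³ − X)` (≅ `E_i`) and `v′² = 32(W⁵ − W)`. -/
theorem standard_models (X W : R) : (2*X)^3 - 4*(2*X) = 8*(X^3 - X) ∧ (2*W)^5 - 16*(2*W) = 32*(W^5 - W) := by
  constructor <;> ring

/-- Exact form `2x²y·d(y/x)/dx = x f_A′ − 2 f_A = 5x⁷ − 21x⁵ + 7x³ + x`, i.e. `[x⁻¹dx/y] = −5ω₅ + 21ω₃ − 7ω₁`. -/
theorem exact_k1 : x * fAd x - 2 * fA x = x^2 * (5*x^5 - 21*x^3 + 7*x) + x := by unfold fA fAd; ring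

/-- Exact form `2x³y·d(y/x²)/dx = x f_A′ − 4 f_A = 3x⁷ − 7x⁵ − 7x³ + 3x`, i.e. `[x⁻²dx/y] = −ω₄ + (7/3)(ω₂ + ω₀)`. -/
theorem exact_k2 : x * fAd x - 4 * fA x = x^3 * (3*x^4 - 7*x^2 - 7) + 3*x := by unfold fA fAd; ring

/-- Exact form `2x⁴y·d(y/x³)/dx = x f_A′ − 6 f_A = x⁷ + 7x⁵ − 21x³ + 5x`, i.e. `5[x⁻³dx/y] = −ω₃ − 7ω₁ + 21[x⁻¹dx/y]`. -/
theorem exact_k3 : x * fAd x - 6 * fA x = x^4 * (x^3 + 7*x) - 21*x^3 + 5*x := by unfold fA fAd; ring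

/-- The resulting reduction vector of `x⁻³dx/y`: `−(1/5)(x³ + 7x + 21(5x⁵ − 21x³ + 7x)) = −21x⁵ + 88x³ − (154/5)x`
(stated with denominators cleared). -/
theorem reduce_k3 : -(x^3 + 7*x + 21*(5*x^5 - 21*x^3 + 7*x)) = 5*(-21*x^5 + 88*x^3) - 154*x := by ring

/-- Whole-family version of `exact_k2`: for `f = x⁷ − s₁x⁵ + s₂x³ − s₃x`, `x f′ − 4f = 3x⁷ − s₁x⁵ − s₂x³ + 3s₃x`
(so `ε*`-type reductions of `x⁻²dx/y` exist for every member; only the anchor has `ε`). -/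
theorem exact_k2_general (s₁ s₂ s₃ : R) :
    x * (7*x^6 - 5*s₁*x^4 + 3*s₂*x^2 - s₃) - 4 * (x^7 - s₁*x^5 + s₂*x^3 - s₃*x)
      = 3*x^7 - s₁*x^5 - s₂*x^3 + 3*s₃*x := by ring

/-- Rotation covariance of the branch form: with `a² + 2a − 1 = 0` (`a = tan(π/8)`),
`F_A(x + a, 1 − a x) = −(1 + a²)⁴ · F_A(x, 1)` — the Möbius rotation `x ↦ (x+a)/(1−ax)` by `π/8` preserves the
branch divisor, hence lifts to an automorphism of `C′_anchor` (of order 8 on `x`). -/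
theorem FA_rot (ha : a^2 + 2*a - 1 = 0) : FA (x + a) (1 - a*x) = -(1 + a^2)^4 * FA x 1 := by
  unfold FA
  linear_combination (2*x - 14*x^3 + 14*x^5 - 2*x^7 + 1*a + 4*a*x - 28*a*x^2 - 28*a*x^3 + 70*a*x^4
    + 28*a*x^5 - 28*a*x^6 - 4*a*x^7 + 1*a*x^8 + 2*a^2 - 14*a^2*x - 56*a^2*x^2 + 98*a^2*x^3 + 140*a^2*x^4
    - 98*a^2*x^5 - 56*a^2*x^6 + 14*a^2*x^7 + 2*a^2*x^8 - 2*a^3 - 24*a^3*x + 56*a^3*x^2 + 168*a^3*x^3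
    - 140*a^3*x^4 - 168*a^3*x^5 + 56*a^3*x^6 + 24*a^3*x^7 - 2*a^3*x^8 - 2*a^4 + 14*a^4*x + 56*a^4*x^2
    - 98*a^4*x^3 - 140*a^4*x^4 + 98*a^4*x^5 + 56*a^4*x^6 - 14*a^4*x^7 - 2*a^4*x^8 + 1*a^5 + 4*a^5*x
    - 28*a^5*x^2 - 28*a^5*x^3 + 70*a^5*x^4 + 28*a^5*x^5 - 28*a^5*x^6 - 4*a^5*x^7 + 1*a^5*x^8 - 2*a^6*x
    + 14*a^6*x^3 - 14*a^6*x^5 + 2*a^6*x^7) * ha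

/-- Cayley transform: if `i² = −1` then `F_A(i(1−z), 1+z) = 16 i (z⁸ − 1)`.  With `z = e^{2iθ}`,
`x = i(1−z)/(1+z) = tan θ`, so the branch set is `{tan(kπ/8)}` = the image of the 8th roots of unity:
`C′_anchor ≅_ℂ {y² = x⁸ − 1}`. -/
theorem FA_cayley (I z : R) (hI : I^2 = -1) : FA (I*(1 - z)) (1 + z) = 16*I*(z^8 - 1) := by
  unfold FA
  linear_combination (15*I - 6*I*z - 14*I*z^2 - 14*I*z^3 + 14*I*z^5 + 14*I*z^6 + 6*I*z^7 - 15*I*z^8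
    - 8*I^3 + 20*I^3*z - 28*I^3*z^3 + 28*I^3*z^5 - 20*I^3*z^7 + 8*I^3*z^8 + 1*I^5 - 6*I^5*z + 14*I^5*z^2
    - 14*I^5*z^3 + 14*I^5*z^5 - 14*I^5*z^6 + 6*I^5*z^7 - 1*I^5*z^8) * hI

/-- Cofactor expansion along a constant first column: `det[1 | s | P] = P₁(s₃−s₂) + P₂(s₁−s₃) + P₃(s₂−s₁)`. -/
theorem det_one_col (s₁ s₂ s₃ P₁ P₂ P₃ : R) :
    Matrix.det !![1, s₁, P₁; 1, s₂, P₂; 1, s₃, P₃] = P₁*(s₃ - s₂) + P₂*(s₁ - s₃) + P₃*(s₂ - s₁) := by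
  simp [Matrix.det_fin_three]; ring

/-- The anchor specialisation with `s = (σ, −σ, −γ)` (`σ = sin(π/8)`, `γ = cos(π/8)`) and column scalings
`λ = Ω_E/√2`, `μ = Ω₂`: `det[λ·1 | μ·s | P] = λμ·[(σ−γ)P₁ + (σ+γ)P₂ − 2σP₃]` — the bracket of the even
cofactor identity `Ω₂[(σ−γ)r₁₄ + (σ+γ)r₂₄ − 2σr₃₄] + (2√2/3)π = 0`. -/
theorem det_one_col_anchor (l m σ γ P₁ P₂ P₃ : R) :
    Matrix.det !![l, m*σ, P₁; l, m*(-σ), P₂; l, m*(-γ), P₃] = l*m*((σ - γ)*P₁ + (σ + γ)*P₂ - 2*σ*P₃) := by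
  simp [Matrix.det_fin_three]; ring

/-- Cofactor expansion along the third column (odd frame `(ω₁ | θ | η₊)`):
`det = Q₁m₁ − Q₂m₂ + Q₃m₃` with the 2×2 minors `m₁ = w₂t₃−w₃t₂`, `m₂ = w₁t₃−w₃t₁`, `m₃ = w₁t₂−w₂t₁`. -/
theorem det_third_col (w₁ w₂ w₃ t₁ t₂ t₃ Q₁ Q₂ Q₃ : R) :
    Matrix.det !![w₁, t₁, Q₁; w₂, t₂, Q₂; w₃, t₃, Q₃]
      = Q₁*(w₂*t₃ - w₃*t₂) - Q₂*(w₁*t₃ - w₃*t₁) + Q₃*(w₁*t₂ - w₂*t₁) := by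
  simp [Matrix.det_fin_three]; ring

end ring

section field
variable {K : Type*} [Field K]

/-- `ε`-symmetry in a field: `x⁸·f_A(−1/x) = f_A(x)` for `x ≠ 0` (so `(x,y) ↦ (−1/x, y/x⁴)` preserves `y² = f_A`). -/
theorem fA_eps (x : K) (hx : x ≠ 0) : x^8 * fA (-x⁻¹) = fA x := by
  unfold fA; field_simp; ring

/-- The quotient `E″`: if `y² = f_A(x)`, `x ≠ 0`, then `v = y/x²`, `w = x − 1/x` satisfy `v² = w³ − 4w`. -/
theorem quotientE (x y : K) (hx : x ≠ 0) (hy : y^2 = fA x) :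
    (y / x^2)^2 = (x - x⁻¹)^3 - 4*(x - x⁻¹) := by
  rw [div_pow, hy]; unfold fA; field_simp; ring

/-- The quotient `C₂`: if `y² = f_A(x)`, `x ≠ 0`, then `v′ = y(x²+1)/x³`, `w = x − 1/x` satisfy `v′² = w⁵ − 16w`. -/
theorem quotientC2 (x y : K) (hx : x ≠ 0) (hy : y^2 = fA x) :
    (y * (x^2 + 1) / x^3)^2 = (x - x⁻¹)^5 - 16*(x - x⁻¹) := by
  rw [div_pow, mul_pow, hy]; unfold fA; field_simp; ring

/-- Implicit differentiation bookkeeping: with `y² = f`, `y′ = f′/(2y)`, one has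
`y′/x^k − k·y/x^{k+1} = (x f′ − 2k f)/(2x^{k+1}y)`, the shape used in `exact_k1/2/3`. -/
theorem dquot (x y f fd : K) (k : ℕ) (hx : x ≠ 0) (hy0 : y ≠ 0) (h2 : (2 : K) ≠ 0) (hy : y^2 = f) :
    fd / (2*y) / x^k - k * y / x^(k+1) = (x * fd - 2 * k * f) / (2 * x^(k+1) * y) := by
  rw [← hy]; field_simp; ring

/-- The rotation by `π/8` in the coordinate `x = tan θ`: `μ_a(x) = (x + a)/(1 − a x)`, `a = tan(π/8)`. -/
def rot (a x : K) : K := (x + a) / (1 - a*x)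

/-- One orbit: for `a² + 2a − 1 = 0` (char `≠ 2`), `μ_a` maps `0 ↦ a ↦ 1 ↦ a+2`, `a+2 ↦ ∞` (its denominator
vanishes: `1 − a(a+2) = 0`), `∞ ↦ −1/a = −(a+2)`, `−(a+2) ↦ −1 ↦ −a ↦ 0`.  So the anchor branch set
`{0, ±a, ±1, ±(a+2), ∞}` (`a = √2−1`, `a+2 = √2+1 = 1/a`) is a single orbit of an order-8 rotation. -/
theorem rot_orbit (a : K) (ha : a^2 + 2*a - 1 = 0) (h2 : (2 : K) ≠ 0) :
    rot a 0 = a ∧ rot a a = 1 ∧ rot a 1 = a + 2 ∧ 1 - a*(a + 2) = 0 ∧ a * (a + 2) = 1 ∧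
      rot a (-(a + 2)) = -1 ∧ rot a (-1) = -a ∧ rot a (-a) = 0 := by
  have ha0 : a ≠ 0 := by
    rintro rfl; norm_num at ha
  have h1a : (1 : K) - a * 1 ≠ 0 := by
    intro h
    have : a = 1 := by linear_combination -h
    subst this; apply h2; linear_combination ha
  have h1a' : (1 : K) - a * (-1) ≠ 0 := by
    intro h
    have : a = -1 := by linear_combination h
    subst this; apply h2; linear_combination -ha
  have h1aa : (1 : K) - a * a ≠ 0 := by
    have : (1 : K) - a * a = 2 * a := by linear_combination -ha
    rw [this]; exact mul_ne_zero h2 ha0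
  have hden : (1 : K) - a * (-(a + 2)) ≠ 0 := by
    have : (1 : K) - a * (-(a + 2)) = 2 := by linear_combination ha
    rw [this]; exact h2
  refine ⟨?_, ?_, ?_, ?_, ?_, ?_, ?_, ?_⟩
  · simp [rot]
  · rw [rot, div_eq_iff h1aa]; linear_combination ha
  · rw [rot, div_eq_iff h1a]; linear_combination ha
  · linear_combination -ha
  · linear_combination ha
  · rw [rot, div_eq_iff hden]; linear_combination ha
  · rw [rot, div_eq_iff h1a']; linear_combination ha
  · simp [rot]

end field

section real
open Real

/-- `tan(π/8) = √2 − 1` (so the anchor `a = √2 − 1`, `c = √2 + 1 = cot(π/8) = tan(3π/8)`, `b = 1 = tan(π/4)`). -/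
theorem tan_pi_div_eight : Real.tan (π / 8) = √2 - 1 := by
  have h2 : (√2) ^ 2 = 2 := Real.sq_sqrt (by norm_num)
  have hpos : 0 ≤ √2 - 1 := by
    rw [sub_nonneg]; exact Real.one_le_sqrt.mpr (by norm_num)
  have hc : 0 < √(2 + √2) := Real.sqrt_pos.mpr (by positivity)
  have key : √(2 - √2) = (√2 - 1) * √(2 + √2) := by
    rw [← Real.sqrt_sq hpos, ← Real.sqrt_mul (sq_nonneg _)]
    congr 1
    linear_combination (-√2) * h2
  rw [Real.tan_eq_sin_div_cos, Real.sin_pi_div_eight, Real.cos_pi_div_eight, key]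
  field_simp

end real

section matrices
open Matrix

/-- `ε*` on the even frame `(ω₀, ω₂, ω₄)` (columns = images): `ε*ω₀ = ω₂`, `ε*ω₂ = ω₀`,
`ε*ω₄ = [x⁻²dx/y] = (7/3)ω₀ + (7/3)ω₂ − ω₄`. -/
def epsEven : Matrix (Fin 3) (Fin 3) ℚ := !![0, 1, 7/3; 1, 0, 7/3; 0, 0, -1]

/-- `ε*` on the odd frame `(ω₁, ω₃, ω₅)` (columns = images): `ε*ω₁ = −ω₁`, `ε*ω₃ = −[x⁻¹dx/y] = 7ω₁ − 21ω₃ + 5ω₅`,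
`ε*ω₅ = −[x⁻³dx/y] = (154/5)ω₁ − 88ω₃ + 21ω₅`. -/
def epsOdd : Matrix (Fin 3) (Fin 3) ℚ := !![-1, 7, 154/5; 0, -21, -88; 0, 5, 21]

/-- `ε*` is an involution on `E`. -/
theorem epsEven_sq : epsEven * epsEven = 1 := by
  ext i j; fin_cases i <;> fin_cases j <;> norm_num [epsEven, Matrix.mul_apply, Fin.sum_univ_three, Matrix.cons_val_zero, Matrix.cons_val_one, Matrix.cons_val_two, Matrix.head_cons, Matrix.tail_cons]

/-- `ε*` is an involution on `O`. -/
theorem epsOdd_sq : epsOdd * epsOdd = 1 := by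
  ext i j; fin_cases i <;> fin_cases j <;> norm_num [epsOdd, Matrix.mul_apply, Fin.sum_univ_three, Matrix.cons_val_zero, Matrix.cons_val_one, Matrix.cons_val_two, Matrix.head_cons, Matrix.tail_cons]

/-- `ω₊ = ω₀ + ω₂` (pulled back from `E″`: `dw/v`) is `ε`-invariant. -/
theorem omegaPlus_fixed : epsEven.mulVec ![1, 1, 0] = ![1, 1, 0] := by
  ext i; fin_cases i <;> norm_num [epsEven, Matrix.mulVec, dotProduct, Fin.sum_univ_three, Matrix.cons_val_zero, Matrix.cons_val_one, Matrix.cons_val_two, Matrix.head_cons, Matrix.tail_cons]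

/-- `ω₋ = ω₂ − ω₀` (pulled back from `C₂`: `w dw/v′`) is `ε`-anti-invariant. -/
theorem omegaMinus_anti : epsEven.mulVec ![-1, 1, 0] = -![-1, 1, 0] := by
  ext i; fin_cases i <;> norm_num [epsEven, Matrix.mulVec, dotProduct, Fin.sum_univ_three, Matrix.cons_val_zero, Matrix.cons_val_one, Matrix.cons_val_two, Matrix.head_cons, Matrix.tail_cons]

/-- `ω₄⁽²⁾ = ω₄ − (7/6)ω₊` is `ε`-anti-invariant (`λ = 7/3`). -/
theorem omega4_anti : epsEven.mulVec ![-7/6, -7/6, 1] = -![-7/6, -7/6, 1] := by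
  ext i; fin_cases i <;> norm_num [epsEven, Matrix.mulVec, dotProduct, Fin.sum_univ_three, Matrix.cons_val_zero, Matrix.cons_val_one, Matrix.cons_val_two, Matrix.head_cons, Matrix.tail_cons]

/-- `η₊ = 7ω₁ − 20ω₃ + 5ω₅ = [w dw/v]` (second kind, from `E″`) is `ε`-invariant. -/
theorem etaPlus_fixed : epsOdd.mulVec ![7, -20, 5] = ![7, -20, 5] := by
  ext i; fin_cases i <;> norm_num [epsOdd, Matrix.mulVec, dotProduct, Fin.sum_univ_three, Matrix.cons_val_zero, Matrix.cons_val_one, Matrix.cons_val_two, Matrix.head_cons, Matrix.tail_cons]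

/-- `ω₁` (pulled back from `C₂`: `dw/v′`) is `ε`-anti-invariant. -/
theorem omega1_anti : epsOdd.mulVec ![1, 0, 0] = -![1, 0, 0] := by
  ext i; fin_cases i <;> norm_num [epsOdd, Matrix.mulVec, dotProduct, Fin.sum_univ_three, Matrix.cons_val_zero, Matrix.cons_val_one, Matrix.cons_val_two, Matrix.head_cons, Matrix.tail_cons]

/-- `θ = −22ω₃ + 5ω₅` (`[w²dw/v′] = −θ − 9ω₁`, from `C₂`) is `ε`-anti-invariant. -/
theorem theta_anti : epsOdd.mulVec ![0, -22, 5] = -![0, -22, 5] := by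
  ext i; fin_cases i <;> norm_num [epsOdd, Matrix.mulVec, dotProduct, Fin.sum_univ_three, Matrix.cons_val_zero, Matrix.cons_val_one, Matrix.cons_val_two, Matrix.head_cons, Matrix.tail_cons]

/-- The adapted even frame `(ω₊, ω₋, ω₄⁽²⁾)` has determinant `2` over `(ω₀, ω₂, ω₄)`: `det(ω₊,ω₋,·) = 2·D_even`. -/
theorem evenFrame_det : Matrix.det (!![1, 1, 0; -1, 1, 0; -7/6, -7/6, 1] : Matrix (Fin 3) (Fin 3) ℚ) = 2 := by
  norm_num [Matrix.det_fin_three, Matrix.cons_val_zero, Matrix.cons_val_one, Matrix.cons_val_two, Matrix.head_cons, Matrix.tail_cons]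

/-- The adapted odd frame `(ω₁, θ, η₊)` has determinant `−10` over `(ω₁, ω₃, ω₅)`: `det(ω₁,θ,η₊) = −10·D_odd`. -/
theorem oddFrame_det : Matrix.det (!![1, 0, 0; 0, -22, 5; 7, -20, 5] : Matrix (Fin 3) (Fin 3) ℚ) = -10 := by
  norm_num [Matrix.det_fin_three, Matrix.cons_val_zero, Matrix.cons_val_one, Matrix.cons_val_two, Matrix.head_cons, Matrix.tail_cons]

end matrices

section derivative
open Polynomial
variable {S : Type*} [CommRing S]

/-- `f_A′` IS the `x`-derivative of `f_A` (as polynomials over any commutative ring). -/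
theorem fAd_eq_derivative : derivative (fA (X : S[X])) = fAd (X : S[X]) := by
  simp only [fA, fAd, derivative_sub, derivative_add, derivative_mul, derivative_X_pow, derivative_X,
    derivative_ofNat, zero_mul, zero_add, map_natCast]
  push_cast
  ring

end derivative

section E2

/-- `E₂ : T² = z³ + 2z² − 2z − 4 = (z+2)(z²−2)`, the elliptic curve with CM by `ℤ[√−2]` met at the anchor. -/
def E2 : WeierstrassCurve ℚ := { a₁ := 0, a₂ := 2, a₃ := 0, a₄ := -2, a₆ := -4 }

/-- The cubic factorisation. -/
theorem E2_cubic {R : Type*} [CommRing R] (z : R) : (z + 2) * (z^2 - 2) = z^3 + 2*z^2 - 2*z - 4 := by ring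

/-- `c₄(E₂) = 160`. -/
theorem E2_c4 : E2.c₄ = 160 := by
  norm_num [E2, WeierstrassCurve.c₄, WeierstrassCurve.b₂, WeierstrassCurve.b₄]

/-- `Δ(E₂) = 512 = 2⁹`. -/
theorem E2_Δ : E2.Δ = 512 := by
  norm_num [E2, WeierstrassCurve.Δ, WeierstrassCurve.b₂, WeierstrassCurve.b₄, WeierstrassCurve.b₆,
    WeierstrassCurve.b₈]

/-- `j(E₂) = c₄³/Δ = 8000 = 20³`, the `j`-invariant of `ℤ[√−2]`. -/
theorem E2_j : E2.c₄ ^ 3 = 8000 * E2.Δ := by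
  rw [E2_c4, E2_Δ]; norm_num

end E2

end AnchorFrame
end SoloBlind
end Summit.KontsevichZagierPeriods.KontsevichZagierPeriods.Theorems
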